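import Summits.RiemannHypothesis.RiemannHypothesis.Theorems.UniversalFactorNarrowKernelNoGoEnergyLowerTerms
import Summits.RiemannHypothesis.RiemannHypothesis.Theorems.UniversalFactorNarrowKernelNoGoEnergyLowerKernel
import Mathlib.MeasureTheory.Integral.Prod

/-!
# RiemannHypothesis / UniversalFactor — `NarrowKernelNoGo`, line `Sketch`, stub K1a (energy lower
bound): Fubini for the smoothed Hardy function against the test polynomial, and the duality step

Route `RiemannHypothesis/UniversalFactor`, crux `NarrowKernelNoGo` (stmt-RiemannHypothesis-2576), stub
`UniversalFactor.stub_narrowEnergyLowerClean` (lead). With `g(t) = ∫ κ_a(u) Z(t+u) du` and a test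
polynomial `D(t) = Σ_{n≤P} c_n n^{it}` on the block `B = [T', T' + U]` (`T' > 0`):

* `UniversalFactor.narrowFubini_integrable` / `UniversalFactor.narrowFubini` —
  `∫_B g(t) conj(E₁ t) D(t) dt = ∫ℝ κ_a(u) (∫_B Z(t+u) conj(E₁ t) D(t) dt) du`, and the `u`-integrand
  is integrable (the double integrand is dominated by `(2 + 2(T'+U)) (Σ‖c_n‖) (1+|u|) κ_a(u)`);
* `UniversalFactor.narrowMain_identity` — `∫ℝ κ_a(u) e^{iuL} Σ c_n n^{-1/2} e^{−iu log n} du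
  = Σ c_n n^{-1/2} q_n`, `q_n = ∫ κ_a(u) e^{i(L − log n)u} du`;
* `UniversalFactor.narrow_duality` — Cauchy–Schwarz: `‖∫_B g conj(E₁) D‖² ≤ (∫_B g²)(∫_B ‖D‖²)`.

References: Titchmarsh (1986) §7.3.
-/

noncomputable section

-- D-0017: `Summit.<S>.<S>.…` is the designed namespace of a single-problem summit.
set_option linter.dupNamespace false

namespace Summit.RiemannHypothesis.RiemannHypothesis.Theorems

open MeasureTheory Set Filter Complex intervalIntegral
open scoped Real Topology ComplexConjugate
open Literature.NumberTheory.LFunctions Literature.NumberTheory.LFunctions.TwistedMoment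

/-! ## The double integrand and its domination -/

/-- `‖conj(E₁ t) D(t)‖ ≤ Σ ‖c_n‖`. [folklore] -/
theorem UniversalFactor.norm_conj_thetaMainPhase_mul_dirichlet_le (P : ℕ) (c : ℕ → ℂ) (t : ℝ) :
    ‖conj (thetaMainPhase t) * ∑ n ∈ Finset.Icc 1 P, c n * (n : ℂ) ^ ((t : ℂ) * I)‖ ≤
      ∑ n ∈ Finset.Icc 1 P, ‖c n‖ := by
  rw [norm_mul, Complex.norm_conj, norm_thetaMainPhase, one_mul]
  refine (norm_sum_le _ _).trans (Finset.sum_le_sum fun n hn => ?_)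
  rw [norm_mul, SWTools.norm_natCast_cpow_mul_I (Finset.mem_Icc.1 hn).1, mul_one]

/-- The double integrand `F(t,u) = κ_a(u) Z(t+u) conj(E₁ t) D(t)` is continuous on `(0,∞) × ℝ`. [folklore] -/
theorem UniversalFactor.narrowFubini_continuousOn (a : ℝ) (P : ℕ) (c : ℕ → ℂ) :
    ContinuousOn (fun z : ℝ × ℝ => ((Real.exp (-(2 * a * |z.2|)) * Real.exp (-(π * z.2 / 4)) : ℝ) : ℂ) *
      ((hardyZ (z.1 + z.2) : ℂ) * (conj (thetaMainPhase z.1) *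
        ∑ n ∈ Finset.Icc 1 P, c n * (n : ℂ) ^ ((z.1 : ℂ) * I)))) (Ioi (0 : ℝ) ×ˢ univ) := by
  have h1 : Continuous fun z : ℝ × ℝ => ((Real.exp (-(2 * a * |z.2|)) * Real.exp (-(π * z.2 / 4)) : ℝ) : ℂ) :=
    Complex.continuous_ofReal.comp ((UniversalFactor.continuous_narrowKer a).comp continuous_snd)
  have h2 : Continuous fun z : ℝ × ℝ => (hardyZ (z.1 + z.2) : ℂ) :=
    Complex.continuous_ofReal.comp (continuous_hardyZ.comp (continuous_fst.add continuous_snd))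
  have h3 : ContinuousOn (fun z : ℝ × ℝ => conj (thetaMainPhase z.1)) (Ioi (0 : ℝ) ×ˢ univ) :=
    Complex.continuous_conj.comp_continuousOn
      (continuousOn_thetaMainPhase.comp continuous_fst.continuousOn fun z hz => hz.1)
  have h4 : Continuous fun z : ℝ × ℝ => ∑ n ∈ Finset.Icc 1 P, c n * (n : ℂ) ^ ((z.1 : ℂ) * I) :=
    (continuous_dirichletPoly P c).comp continuous_fst
  exact h1.continuousOn.mul (h2.continuousOn.mul (h3.mul h4.continuousOn))

/-- **Integrability of the double integrand** on `(T', T'+U] × ℝ` (`T' > 0`, `a > π/8`). [folklore] -/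
theorem UniversalFactor.narrowFubini_integrable {a : ℝ} (ha : π / 8 < a) (P : ℕ) (c : ℕ → ℂ) {T' U : ℝ}
    (hT' : 0 < T') (hU : 0 ≤ U) :
    Integrable (fun z : ℝ × ℝ => ((Real.exp (-(2 * a * |z.2|)) * Real.exp (-(π * z.2 / 4)) : ℝ) : ℂ) *
      ((hardyZ (z.1 + z.2) : ℂ) * (conj (thetaMainPhase z.1) *
        ∑ n ∈ Finset.Icc 1 P, c n * (n : ℂ) ^ ((z.1 : ℂ) * I))))
      ((volume.restrict (Ioc T' (T' + U))).prod volume) := by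
  set B : ℝ := (2 + 2 * (T' + U)) * ∑ n ∈ Finset.Icc 1 P, ‖c n‖ with hB
  have hB0 : 0 ≤ B := by positivity
  -- the dominating function `B · (1+|u|) κ(u)` on the product
  have hg1 : Integrable (fun _ : ℝ => (B : ℝ)) (volume.restrict (Ioc T' (T' + U))) := by
    have : IsFiniteMeasure (volume.restrict (Ioc T' (T' + U))) := by
      refine ⟨?_⟩
      rw [Measure.restrict_apply_univ]
      exact measure_Ioc_lt_top
    exact integrable_const _
  have hg2 := UniversalFactor.narrow_integrable_pow_mul_ker ha 1
  have hg := hg1.mul_prod hg2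
  have hmeas : MeasurableSet (Ioc T' (T' + U) ×ˢ (univ : Set ℝ)) := measurableSet_Ioc.prod MeasurableSet.univ
  have hμ : (volume.restrict (Ioc T' (T' + U))).prod (volume : Measure ℝ) =
      ((volume : Measure ℝ).prod (volume : Measure ℝ)).restrict (Ioc T' (T' + U) ×ˢ univ) := by
    rw [← Measure.prod_restrict, Measure.restrict_univ]
  refine hg.mono' ?_ ?_
  · rw [hμ]
    refine ContinuousOn.aestronglyMeasurable ?_ hmeas
    exact (UniversalFactor.narrowFubini_continuousOn a P c).mono
      (prod_mono (fun t ht => hT'.trans ht.1) (subset_univ _))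
  · rw [hμ, ae_restrict_iff' hmeas]
    refine Eventually.of_forall fun z hz => ?_
    obtain ⟨ht, -⟩ := hz
    have ht' : |z.1| ≤ T' + U := by
      rw [abs_of_nonneg (hT'.le.trans ht.1.le)]; exact ht.2
    have hκZ := UniversalFactor.abs_narrowKer_mul_hardyZ_le (a := a) (u := z.2) ht'
    have hX := UniversalFactor.norm_conj_thetaMainPhase_mul_dirichlet_le P c z.1
    rw [norm_mul, norm_mul, Complex.norm_real, Complex.norm_real, Real.norm_eq_abs, Real.norm_eq_abs,
      ← mul_assoc, ← abs_mul, pow_one]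
    have hκ := UniversalFactor.narrowKer_pos a z.2
    calc |Real.exp (-(2 * a * |z.2|)) * Real.exp (-(π * z.2 / 4)) * hardyZ (z.1 + z.2)| *
        ‖conj (thetaMainPhase z.1) * ∑ n ∈ Finset.Icc 1 P, c n * (n : ℂ) ^ ((z.1 : ℂ) * I)‖
        ≤ (2 + 2 * (T' + U)) * ((1 + |z.2|) * (Real.exp (-(2 * a * |z.2|)) * Real.exp (-(π * z.2 / 4)))) *
          ∑ n ∈ Finset.Icc 1 P, ‖c n‖ := mul_le_mul hκZ hX (norm_nonneg _) (by positivity)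
      _ = B * ((1 + |z.2|) * (Real.exp (-(2 * a * |z.2|)) * Real.exp (-(π * z.2 / 4)))) := by
          simp only [hB]; ring

/-- **Fubini.** For `T' > 0`, `U ≥ 0`, `a > π/8`:
`∫_{T'}^{T'+U} g(t) conj(E₁ t) D(t) dt = ∫ℝ κ_a(u) ∫_{T'}^{T'+U} Z(t+u) conj(E₁ t) D(t) dt du`, and the
outer integrand is integrable. [folklore] -/
theorem UniversalFactor.narrowFubini {a : ℝ} (ha : π / 8 < a) (P : ℕ) (c : ℕ → ℂ) {T' U : ℝ}
    (hT' : 0 < T') (hU : 0 ≤ U) :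
    (∫ t in T'..(T' + U),
        ((∫ u : ℝ, Real.exp (-(2 * a * |u|)) * Real.exp (-(π * u / 4)) * hardyZ (t + u) : ℝ) : ℂ) *
          (conj (thetaMainPhase t) * ∑ n ∈ Finset.Icc 1 P, c n * (n : ℂ) ^ ((t : ℂ) * I))) =
      ∫ u : ℝ, ((Real.exp (-(2 * a * |u|)) * Real.exp (-(π * u / 4)) : ℝ) : ℂ) *
        ∫ t in T'..(T' + U), (hardyZ (t + u) : ℂ) *
          (conj (thetaMainPhase t) * ∑ n ∈ Finset.Icc 1 P, c n * (n : ℂ) ^ ((t : ℂ) * I)) ∧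
    Integrable (fun u : ℝ => ((Real.exp (-(2 * a * |u|)) * Real.exp (-(π * u / 4)) : ℝ) : ℂ) *
        ∫ t in T'..(T' + U), (hardyZ (t + u) : ℂ) *
          (conj (thetaMainPhase t) * ∑ n ∈ Finset.Icc 1 P, c n * (n : ℂ) ^ ((t : ℂ) * I))) := by
  have hle : T' ≤ T' + U := by linarith
  have hF := UniversalFactor.narrowFubini_integrable ha P c hT' hU
  -- pointwise: the `t`-integrand is the `u`-integral of `F(t, ·)`
  have hinner : ∀ t : ℝ,
      ((∫ u : ℝ, Real.exp (-(2 * a * |u|)) * Real.exp (-(π * u / 4)) * hardyZ (t + u) : ℝ) : ℂ) *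
          (conj (thetaMainPhase t) * ∑ n ∈ Finset.Icc 1 P, c n * (n : ℂ) ^ ((t : ℂ) * I)) =
      ∫ u : ℝ, ((Real.exp (-(2 * a * |u|)) * Real.exp (-(π * u / 4)) : ℝ) : ℂ) *
        ((hardyZ (t + u) : ℂ) * (conj (thetaMainPhase t) * ∑ n ∈ Finset.Icc 1 P, c n * (n : ℂ) ^ ((t : ℂ) * I))) := by
    intro t
    rw [← integral_complex_ofReal, ← MeasureTheory.integral_mul_const]
    refine integral_congr_ae (Eventually.of_forall fun u => ?_)
    push_cast; ring
  -- Fubini on `Ioc T' (T'+U) × ℝ`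
  have hswap := integral_integral_swap
    (f := fun (t u : ℝ) => ((Real.exp (-(2 * a * |u|)) * Real.exp (-(π * u / 4)) : ℝ) : ℂ) *
      ((hardyZ (t + u) : ℂ) * (conj (thetaMainPhase t) * ∑ n ∈ Finset.Icc 1 P, c n * (n : ℂ) ^ ((t : ℂ) * I))))
    hF
  constructor
  · rw [intervalIntegral.integral_of_le hle, setIntegral_congr_fun measurableSet_Ioc (fun t _ => hinner t), hswap]
    refine integral_congr_ae (Eventually.of_forall fun u => ?_)
    try dsimp only
    rw [intervalIntegral.integral_of_le hle, ← MeasureTheory.integral_const_mul]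
  · have h := hF.integral_prod_right
    refine h.congr (Eventually.of_forall fun u => ?_)
    try dsimp only
    rw [intervalIntegral.integral_of_le hle, ← MeasureTheory.integral_const_mul]

/-! ## The main term -/

/-- **The main-term identity**: integrating the frozen diagonal against the kernel recovers the test
coefficients: `∫ κ_a(u) e^{iuL} (Σ c_n n^{-1/2} e^{−iu log n}) du = Σ c_n n^{-1/2} q_n` with
`q_n = ∫ κ_a(u) e^{i(L − log n)u} du`. [folklore] -/
theorem UniversalFactor.narrowMain_identity {a : ℝ} (ha : π / 8 < a) (P : ℕ) (c : ℕ → ℂ) (L : ℝ) :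
    ∫ u : ℝ, ((Real.exp (-(2 * a * |u|)) * Real.exp (-(π * u / 4)) : ℝ) : ℂ) *
        (cexp (I * u * L) * ∑ n ∈ Finset.Icc 1 P,
          c n * ((((n : ℝ) ^ (-(1 / 2 : ℝ)) : ℝ) : ℂ) * cexp (-(I * u * Real.log n)))) =
      ∑ n ∈ Finset.Icc 1 P, c n * (((n : ℝ) ^ (-(1 / 2 : ℝ)) : ℝ) : ℂ) *
        ∫ u : ℝ, ((Real.exp (-(2 * a * |u|)) * Real.exp (-(π * u / 4)) : ℝ) : ℂ) *
          cexp (I * (L - Real.log n) * u) := by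
  have hint : ∀ n : ℕ, Integrable fun u : ℝ => c n * (((n : ℝ) ^ (-(1 / 2 : ℝ)) : ℝ) : ℂ) *
      (((Real.exp (-(2 * a * |u|)) * Real.exp (-(π * u / 4)) : ℝ) : ℂ) * cexp (I * (L - Real.log n) * u)) := by
    intro n
    refine Integrable.const_mul ?_ _
    have hk : Integrable fun u : ℝ => ((Real.exp (-(2 * a * |u|)) * Real.exp (-(π * u / 4)) : ℝ) : ℂ) :=
      (UniversalFactor.narrow_integrable_ker ha).ofReal
    refine hk.mul_of_top_left (memLp_top_of_bound (by fun_prop) 1 (Eventually.of_forall fun u => ?_))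
    rw [show I * ((L : ℂ) - (Real.log n : ℂ)) * (u : ℂ) = (((L - Real.log n) * u : ℝ) : ℂ) * I by push_cast; ring,
      Complex.norm_exp_ofReal_mul_I]
  have heq : ∀ u : ℝ, ((Real.exp (-(2 * a * |u|)) * Real.exp (-(π * u / 4)) : ℝ) : ℂ) *
      (cexp (I * u * L) * ∑ n ∈ Finset.Icc 1 P,
        c n * ((((n : ℝ) ^ (-(1 / 2 : ℝ)) : ℝ) : ℂ) * cexp (-(I * u * Real.log n)))) =
      ∑ n ∈ Finset.Icc 1 P, c n * (((n : ℝ) ^ (-(1 / 2 : ℝ)) : ℝ) : ℂ) *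
        (((Real.exp (-(2 * a * |u|)) * Real.exp (-(π * u / 4)) : ℝ) : ℂ) * cexp (I * (L - Real.log n) * u)) := by
    intro u
    rw [Finset.mul_sum, Finset.mul_sum]
    refine Finset.sum_congr rfl fun n _ => ?_
    have : cexp (I * u * L) * cexp (-(I * u * Real.log n)) = cexp (I * ((L : ℂ) - (Real.log n : ℂ)) * u) := by
      rw [← Complex.exp_add]; congr 1; ring
    rw [← this]; ring
  simp_rw [heq]
  rw [integral_finsetSum _ fun n _ => hint n]
  refine Finset.sum_congr rfl fun n _ => ?_
  rw [MeasureTheory.integral_const_mul]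

/-! ## Duality -/

/-- **Cauchy–Schwarz duality on the block**: for a real continuous `g` and complex continuous `X`,
`‖∫_{T₁}^{T₂} g X‖² ≤ (∫ g²)(∫ ‖X‖²)`. [folklore] -/
theorem UniversalFactor.narrow_duality {g : ℝ → ℝ} {X : ℝ → ℂ} {T₁ T₂ : ℝ} (h12 : T₁ ≤ T₂)
    (hg : ContinuousOn g (Icc T₁ T₂)) (hX : ContinuousOn X (Icc T₁ T₂)) :
    ‖∫ t in T₁..T₂, (g t : ℂ) * X t‖ ^ 2 ≤ (∫ t in T₁..T₂, g t ^ 2) * ∫ t in T₁..T₂, ‖X t‖ ^ 2 := by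
  set A : ℝ := ∫ t in T₁..T₂, g t ^ 2 with hA
  set Bx : ℝ := ∫ t in T₁..T₂, ‖X t‖ ^ 2 with hBx
  have hgc : ContinuousOn (fun t => (g t : ℂ)) (Icc T₁ T₂) := Complex.continuous_ofReal.comp_continuousOn hg
  have hA0 : 0 ≤ A := intervalIntegral.integral_nonneg h12 fun t _ => sq_nonneg _
  have hB0 : 0 ≤ Bx := intervalIntegral.integral_nonneg h12 fun t _ => sq_nonneg _
  have hgnorm : ∫ t in T₁..T₂, ‖(g t : ℂ)‖ ^ 2 = A := by
    refine intervalIntegral.integral_congr fun t _ => ?_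
    simp only [Complex.norm_real, Real.norm_eq_abs, sq_abs]
  -- AM–GM with parameter `η`: `‖∫ g X‖ ≤ (η A + B/η)/2` for every `η > 0`
  have hamgm : ∀ η : ℝ, 0 < η → ‖∫ t in T₁..T₂, (g t : ℂ) * X t‖ ≤ (η * A + Bx / η) / 2 := by
    intro η hη
    have := UniversalFactor.narrow_norm_integral_mul_le_amgm h12 hη hgc hX
    rwa [hgnorm] at this
  set N : ℝ := ‖∫ t in T₁..T₂, (g t : ℂ) * X t‖ with hN
  have hN0 : 0 ≤ N := norm_nonneg _
  -- case analysis on `A = 0` / `B = 0`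
  rcases hA0.eq_or_lt with hA00 | hApos
  · -- `A = 0`: let `η → ∞`
    have hNle : ∀ η : ℝ, 0 < η → N ≤ Bx / η / 2 := fun η hη => by
      have := hamgm η hη; rw [← hA00, mul_zero, zero_add] at this; exact this
    have hN00 : N = 0 := by
      by_contra hne
      have hNpos : 0 < N := lt_of_le_of_ne hN0 (Ne.symm hne)
      have := hNle (Bx / N + 1) (by positivity)
      have h1 : Bx / (Bx / N + 1) / 2 < N := by
        rw [div_div, div_lt_iff₀ (by positivity)]
        have e : N * ((Bx / N + 1) * 2) = 2 * Bx + 2 * N := by field_simp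
        rw [e]; linarith
      linarith
    rw [hN00, ← hA00]; simp
  rcases hB0.eq_or_lt with hB00 | hBpos
  · have hNle : ∀ η : ℝ, 0 < η → N ≤ η * A / 2 := fun η hη => by
      have := hamgm η hη; rw [← hB00, zero_div, add_zero] at this; exact this
    have hN00 : N = 0 := by
      by_contra hne
      have hNpos : 0 < N := lt_of_le_of_ne hN0 (Ne.symm hne)
      have := hNle (N / A) (by positivity)
      have h1 : N / A * A / 2 < N := by
        rw [div_mul_cancel₀ _ hApos.ne']; linarith
      linarith
    rw [hN00, ← hB00]; simp
  -- generic case: `η = √(B/A)`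
  set η : ℝ := Real.sqrt (Bx / A) with hη
  have hηpos : 0 < η := Real.sqrt_pos.2 (div_pos hBpos hApos)
  have hη2 : η ^ 2 = Bx / A := Real.sq_sqrt (div_pos hBpos hApos).le
  have h := hamgm η hηpos
  -- `(η A + B/η)/2 = η A` since `η² A = B`
  have hkey : (η * A + Bx / η) / 2 = η * A := by
    have : Bx / η = η * A := by
      rw [div_eq_iff hηpos.ne']
      have h3 : η * A * η = η ^ 2 * A := by ring
      rw [h3, hη2, div_mul_cancel₀ _ hApos.ne']
    rw [this]; ring
  rw [hkey] at h
  calc N ^ 2 ≤ (η * A) ^ 2 := pow_le_pow_left₀ hN0 h 2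
    _ = η ^ 2 * A * A := by ring
    _ = A * Bx := by rw [hη2, div_mul_cancel₀ _ hApos.ne']; ring

/-- Registered sub-stub `narrowFubini_duality` of crux `stmt-RiemannHypothesis-2576` (binder-free restatement of
`UniversalFactor.narrow_duality`, used by the gate to attach this helper file to the crux). [folklore] -/
theorem UniversalFactor.narrowFubini_duality : ∀ {g : ℝ → ℝ} {X : ℝ → ℂ} {T₁ T₂ : ℝ}, T₁ ≤ T₂ → ContinuousOn g (Set.Icc T₁ T₂) → ContinuousOn X (Set.Icc T₁ T₂) → ‖∫ t in T₁..T₂, (g t : ℂ) * X t‖ ^ 2 ≤ (∫ t in T₁..T₂, g t ^ 2) * ∫ t in T₁..T₂, ‖X t‖ ^ 2 :=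
  fun h12 hg hX => UniversalFactor.narrow_duality h12 hg hX

end Summit.RiemannHypothesis.RiemannHypothesis.Theorems
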